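import Literature.AlgebraicGeometry.AbelianSchemes.SerreTensorHomModule
import Literature.AlgebraicGeometry.AbelianSchemes.SerreTensorPointsNaturality
import Literature.AlgebraicGeometry.AbelianSchemes.AbelianSchemePointsLie
import HarnessLib

/-!
# Restricting `(A ⊗_𝒪 𝔟)(T) ≅ A(T) ⊗_𝒪 𝔟` to submodules cut out coordinatewise; kernels of restriction maps; `Lie(A ⊗_𝒪 𝔟) = Lie(A) ⊗_𝒪 𝔟`

Topic `AlgebraicGeometry/AbelianSchemes`, namespace `Literature.AlgebraicGeometry.AbelianSchemes.AbelianSchemeOver` (constructions with bodies + proved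
theorems; no named fact, no `sorry`, no `instance`, no notation; ANY base scheme `S` in §1–§2, an affine base `Spec R` in §3).  Cell `hodgecm-mathlib`, F0/P6
«MOD», organ **(B1) «`Lie(A ⊗ 𝔟) ≅ Lie(A) ⊗_𝒪 𝔟`»** of the Serre-tensor family (desk F0P6a-plan (g0) ED3-CENSUS-P6a v1 §6 «(B) LIE∕KOTTWITZ TRANSPORT … GEN-useful»),
together with the GENERIC restriction lemma behind ★ `serreHomFixedEquiv` (p845207) and ★ `serrePtsTorsionEquiv` ((C)); over ★ `SerreTensorPoints` (p845057),
★ `SerreTensorPointsNaturality` (p845084), ★ `SerreTensorHomModule` (`coe_smulVecLin_subtype`), ★ `AbelianSchemePointsLie` (`AbelianScheme.Lie`);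
`--supports stmt-HodgeConjecture-24832`, count-neutral.  HC_CM is proved only modulo the 2 remaining named inputs (hLiu418, h413) until rung 0 closes; this
file discharges none of them.

## Mathematics

(§1) If an `𝒪`-submodule `N′ ⊆ (A ⊗ 𝔟)(T)` is cut out COORDINATEWISE by a submodule `N ⊆ A(T)` — `x ∈ N′ ↔ ∀ k, Ψ(x)_k ∈ N` for the points
isomorphism `Ψ : (A ⊗ 𝔟)(T) ≅ {v ∈ A(T)ⁿ : E·v = v}` (★ `serrePtsEquiv`) — then `N′ ≃ₗ[𝒪] {v ∈ Nⁿ : E·v = v} ≃ₗ[𝒪] N ⊗_𝒪 𝔟` (★ `tensorRangeEquivFixed`):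
«`⊗ 𝔟` is exact».  (§2) For any `t : T′ → T` the KERNEL of the restriction `(A ⊗ 𝔟)(T) → (A ⊗ 𝔟)(T′)` is cut out by the kernel of `A(T) → A(T′)`
(naturality of `Ψ`, ★ `serrePtsEquiv_comap_coe`), so `ker((A ⊗ 𝔟)(T) → (A ⊗ 𝔟)(T′)) ≅ ker(A(T) → A(T′)) ⊗_𝒪 𝔟`.  (§3) Over `S = Spec R` with
`T = Spec R[ε] → T′ = Spec R` (`ε ↦ 0`) these kernels are the LIE ALGEBRAS (★ `AbelianScheme.Lie` = `ker(A(R[ε]) → A(R))`,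
[GortzWedhorn2020] (6.4); [Kottwitz1992] §5 (5.2)): **`Lie(A ⊗_𝒪 𝔟) ≃ₗ[𝒪] Lie(A) ⊗_𝒪 𝔟`** as `𝒪`-modules (B. Conrad, *Gross–Zagier revisited* §7
Thm. 7.5: `M ⊗_A 𝔐` has tangent space `M ⊗_A Lie(𝔐)`, relative dimension `rank(M)·dim`).  The `R`-module structure of `Lie` (★ `lieSMul`, by the
scalings `ε ↦ rε`) is respected because `Ψ` is natural in EVERY `t` (§2 `serrePtsEquiv_comap_coe`); the chart∕conormal `lieCharpoly` (Kottwitz condition) is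
not touched here.

## Contents

* §1 **`serrePtsRestrictEquiv`** (`N′ ≃ₗ[O] fixedSubmodule N E` under the coordinatewise hypothesis; `_coe`), **`serrePtsRestrictTensorEquiv`** (`≃ₗ[O] N ⊗[O] range E`),
  `serrePtsRestrictTensorEquiv_symm_tmul_coe`.
* §2 `mem_ker_comap_iff_coords`, **`serrePtsKerComapEquiv`** (`ker (comap_{A⊗𝔟} t) ≃ₗ[O] ker (comap_A t) ⊗[O] range E`).
* §3 (`S = Spec R`) **`RingAction.lieSubmodule act`** (`:= ker (A(R[ε]) → A(R))` as an `𝒪`-submodule of `A(R[ε])`), `mem_lieSubmodule_iff`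
  (`↔ hom x ∈ A.toAffine.Lie`), **`serreLieEquiv : lieSubmodule (serreAction act E hE) ≃ₗ[O] lieSubmodule act ⊗[O] range E`**.

## References
* [Conrad2004GrossZagier] B. Conrad, *Gross–Zagier revisited*, MSRI Publ. 49 (2004), §7 Thm. 7.5.
* [GortzWedhorn2020] U. Görtz, T. Wedhorn, *Algebraic Geometry I* (2nd ed.), Section (6.4) (p. 155) (tangent space via dual numbers).
* [Kottwitz1992] R. Kottwitz, JAMS 5 (1992), §5 (5.2) (p. 390) (`Lie(A)` with its `𝒪_B`-action).
* Tree: ★ `SerreTensorPoints`, ★ `SerreTensorPointsNaturality`, ★ `SerreTensorHomModule`, ★ `AbelianSchemePointsLie`.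
-/

noncomputable section

universe u

open CategoryTheory CategoryTheory.Limits AlgebraicGeometry MonoidalCategory CartesianMonoidalCategory
open scoped MonObj TensorProduct

namespace Literature.AlgebraicGeometry.AbelianSchemes

namespace AbelianSchemeOver

open Literature.Algebra.Module.IdempotentMatrix RingAction
open Literature.AlgebraicGeometry.Motives (SchemeOver specOver)

variable {S : Scheme.{u}} {A : AbelianSchemeOver S} {O : Type*} [CommRing O] (act : A.RingAction O) [IsCommMonObj A.X]
  {n : ℕ} (E : Matrix (Fin n) (Fin n) O) (hE : E * E = E)

/-! ## §1 The generic restriction: submodules of `(A ⊗ 𝔟)(T)` cut out coordinatewise -/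

section Restrict

variable (T : Over S) [IsCommMonObj (serreTensor act E hE).X] (N' : Submodule O ((serreAction act E hE).Pts T)) (N : Submodule O (act.Pts T))
  (hN : ∀ x, x ∈ N' ↔ ∀ k, (serrePtsEquiv act E hE T x : Fin n → act.Pts T) k ∈ N)

/-- **`N′ ≃ₗ[𝒪] Fix_E(Nⁿ)`** for a submodule `N′ ⊆ (A ⊗ 𝔟)(T)` cut out coordinatewise by `N ⊆ A(T)` (★ `serrePtsEquiv` restricted).
[cite: Conrad2004GrossZagier, §7 (Thm. 7.5)] -/
def serrePtsRestrictEquiv : N' ≃ₗ[O] fixedSubmodule N E where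
  toFun x := ⟨fun k => ⟨(serrePtsEquiv act E hE T x.1 : Fin n → act.Pts T) k, (hN x.1).1 x.2 k⟩, by
    rw [mem_fixedSubmodule_iff]
    funext j
    apply Subtype.ext
    rw [coe_smulVecLin_subtype]
    exact congrFun ((mem_fixedSubmodule_iff _ E _).1 (serrePtsEquiv act E hE T x.1).2) j⟩
  invFun v := ⟨(serrePtsEquiv act E hE T).symm ⟨fun k => ((v : Fin n → N) k : act.Pts T), by
      rw [mem_fixedSubmodule_iff]
      funext j
      have h := congrFun ((mem_fixedSubmodule_iff _ E _).1 v.2) j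
      rw [← coe_smulVecLin_subtype, h]⟩,
    (hN _).2 fun k => by
      rw [LinearEquiv.apply_symm_apply]
      exact ((v : Fin n → N) k).2⟩
  map_add' x y := by
    apply Subtype.ext; funext k; apply Subtype.ext
    change (serrePtsEquiv act E hE T (x.1 + y.1) : Fin n → act.Pts T) k = _
    rw [map_add]
    rfl
  map_smul' c x := by
    apply Subtype.ext; funext k; apply Subtype.ext
    change (serrePtsEquiv act E hE T (c • x.1) : Fin n → act.Pts T) k = _
    rw [map_smul]
    rfl
  left_inv x := by
    apply Subtype.ext
    change (serrePtsEquiv act E hE T).symm _ = x.1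
    rw [LinearEquiv.symm_apply_eq]
  right_inv v := by
    apply Subtype.ext; funext k; apply Subtype.ext
    change (serrePtsEquiv act E hE T ((serrePtsEquiv act E hE T).symm _) : Fin n → act.Pts T) k = _
    rw [LinearEquiv.apply_symm_apply]

/-- Coordinates of `serrePtsRestrictEquiv x` are those of ★ `serrePtsEquiv`. [cite: Conrad2004GrossZagier, §7 (Thm. 7.5)] -/
theorem serrePtsRestrictEquiv_coe (x : N') (k : Fin n) :
    (((serrePtsRestrictEquiv act E hE T N' N hN x : Fin n → N) k : act.Pts T)) = (serrePtsEquiv act E hE T x.1 : Fin n → act.Pts T) k := rfl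

/-- **`N′ ≃ₗ[𝒪] N ⊗_𝒪 𝔟`** (`𝔟 = E·𝒪ⁿ`): «`⊗ 𝔟` is exact» on points of Serre tensors. [cite: Conrad2004GrossZagier, §7 (Thm. 7.5)] -/
def serrePtsRestrictTensorEquiv : N' ≃ₗ[O] N ⊗[O] LinearMap.range (Matrix.toLin' E) :=
  (serrePtsRestrictEquiv act E hE T N' N hN).trans (tensorRangeEquivFixed N E hE).symm

/-- On pure tensors the inverse sends `y ⊗ v` to the element with coordinates `(v_k • y)_k`. [cite: Conrad2004GrossZagier, §7 (Thm. 7.5)] -/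
theorem serrePtsRestrictTensorEquiv_symm_tmul_coe (y : N) (v : LinearMap.range (Matrix.toLin' E)) (k : Fin n) :
    (((serrePtsRestrictEquiv act E hE T N' N hN ((serrePtsRestrictTensorEquiv act E hE T N' N hN).symm (y ⊗ₜ v)) : Fin n → N) k :
      act.Pts T)) = (v : Fin n → O) k • (y : act.Pts T) := by
  change (((serrePtsRestrictEquiv act E hE T N' N hN ((serrePtsRestrictEquiv act E hE T N' N hN).symm
    (tensorRangeEquivFixed N E hE (y ⊗ₜ v))) : Fin n → N) k : act.Pts T)) = _
  rw [LinearEquiv.apply_symm_apply, tensorRangeEquivFixed_tmul_coe, Submodule.coe_smul]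

end Restrict

/-! ## §2 Kernels of restriction maps `(A ⊗ 𝔟)(T) → (A ⊗ 𝔟)(T′)` -/

section KerComap

variable {T T' : Over S} (t : T' ⟶ T) [IsCommMonObj (serreTensor act E hE).X]

/-- The kernel of `(A ⊗ 𝔟)(T) → (A ⊗ 𝔟)(T′)` is cut out coordinatewise by the kernel of `A(T) → A(T′)` (naturality of `Ψ`).
[cite: Conrad2004GrossZagier, §7 (Thm. 7.5)] -/
theorem mem_ker_comap_iff_coords (x : (serreAction act E hE).Pts T) :
    x ∈ LinearMap.ker (Pts.comap (serreAction act E hE) t) ↔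
      ∀ k, (serrePtsEquiv act E hE T x : Fin n → act.Pts T) k ∈ LinearMap.ker (Pts.comap act t) := by
  simp only [LinearMap.mem_ker]
  constructor
  · intro h k
    rw [← serrePtsEquiv_comap_coe, h, map_zero]
    rfl
  · intro h
    apply (serrePtsEquiv act E hE T').injective
    rw [map_zero]
    apply Subtype.ext
    funext k
    rw [serrePtsEquiv_comap_coe]
    exact h k

/-- **`ker((A ⊗ 𝔟)(T) → (A ⊗ 𝔟)(T′)) ≃ₗ[𝒪] ker(A(T) → A(T′)) ⊗_𝒪 𝔟`.** [cite: Conrad2004GrossZagier, §7 (Thm. 7.5)] -/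
def serrePtsKerComapEquiv :
    LinearMap.ker (Pts.comap (serreAction act E hE) t) ≃ₗ[O] LinearMap.ker (Pts.comap act t) ⊗[O] LinearMap.range (Matrix.toLin' E) :=
  serrePtsRestrictTensorEquiv act E hE T _ _ (mem_ker_comap_iff_coords act E hE t)

end KerComap

/-! ## §3 `Lie(A ⊗_𝒪 𝔟) ≅ Lie(A) ⊗_𝒪 𝔟` over an affine base -/

section Lie

variable {R : Type u} [CommRing R] {B : AbelianSchemeOver (Spec (.of R))} (actB : B.RingAction O) [IsCommMonObj B.X]

/-- **`Lie(B)` as an `𝒪`-submodule of `B(R[ε])`**: the kernel of `B(R[ε]) → B(R)` (`ε ↦ 0`) in the `𝒪`-module of points (★ `Pts`) — the same carrier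
as ★ `AbelianScheme.Lie` (a subgroup), see `mem_lieSubmodule_iff`. [cite: GortzWedhorn2020, Section (6.4) (p. 155)] [cite: Kottwitz1992, §5 (5.2) (p. 390)] -/
def RingAction.lieSubmodule : Submodule O (actB.Pts (specOver R (DualNumber R))) :=
  LinearMap.ker (Pts.comap actB (AbelianScheme.specOverMap (TrivSqZeroExt.fstHom R R R)))

/-- `x ∈ Lie` (module) iff `hom x ∈ B.toAffine.Lie` (★ subgroup): both say `Spec(ε ↦ 0) ≫ x = 1`. [cite: GortzWedhorn2020, Section (6.4) (p. 155)] -/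
theorem RingAction.mem_lieSubmodule_iff (x : actB.Pts (specOver R (DualNumber R))) :
    x ∈ actB.lieSubmodule ↔ (Pts.hom actB _ x : B.toAffine.Points (DualNumber R)) ∈ B.toAffine.Lie := by
  change Pts.comap actB (AbelianScheme.specOverMap (TrivSqZeroExt.fstHom R R R)) x = 0 ↔
    AbelianScheme.specOverMap (TrivSqZeroExt.fstHom R R R) ≫ Pts.hom actB _ x = 1
  exact (Pts.hom_injective actB (specOver R R)).eq_iff.symm

variable {A : AbelianSchemeOver (Spec (.of R))} (act : A.RingAction O) [IsCommMonObj A.X] (E : Matrix (Fin n) (Fin n) O) (hE : E * E = E)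
  [IsCommMonObj (serreTensor act E hE).X]

/-- **`Lie(A ⊗_𝒪 𝔟) ≃ₗ[𝒪] Lie(A) ⊗_𝒪 𝔟`** (`𝔟 = E·𝒪ⁿ`): the tangent space of a Serre tensor ([Conrad2004GrossZagier] Thm. 7.5).
[cite: Conrad2004GrossZagier, §7 (Thm. 7.5)] [cite: Kottwitz1992, §5 (5.2) (p. 390)] -/
def serreLieEquiv :
    (serreAction act E hE).lieSubmodule ≃ₗ[O] act.lieSubmodule ⊗[O] LinearMap.range (Matrix.toLin' E) :=
  serrePtsKerComapEquiv act E hE (AbelianScheme.specOverMap (TrivSqZeroExt.fstHom R R R))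

end Lie

end AbelianSchemeOver

end Literature.AlgebraicGeometry.AbelianSchemes

end
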